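import Summits.QuantumFields.BalabanUV.Beta.D1BFx.GhostWordJetMass

/-!
# `BalabanUV.Beta.D1BFx.RestNestedMass` — road «BF-x» for binder row D1, slot (K), DICT-CHAIN-SPEC §2 (II) rows RK-BLK ∕ RK-SAND: **THE PLAIN MASS OF A NESTED
# SUPERPOSITION** `Σ_i wsum (w₁ i) (u ↦ Σ_{i′} wsum (w₂ i′) (P i u i′))` from two weight envelopes `C₁·e^{−a|u−c₁|₁}`, `C₂·e^{−a|u′−c₂|₁}` and the pair stencils'
# own letter `Σ'|P i u i′ u′| ≤ mT·e^{−δ|u′−u|₁}`: `≤ |ι|²·C₁·C₂·mT·Zl D (a∕2)·Zl D (δ∕2)·e^{−min (a∕2) (δ∕2)·|c₂−c₁|₁}` — generic dimension `D`, fibre `F`, colour set `ι`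
# (the generic half of «RK-TABLE BLOCK MASSES»; the packed second-order tables `vertex2OfK K n S₂` are such nested superpositions block by block — FILE `RestTableBlockMass`)

STATUS: [folklore] `ℓ¹` bookkeeping over this lineage's `GhostWordJetMass.mass_wsum_le` ∕ `mass_finset_sum_le` (g18 FILE 3a) and an2's `ExpKernelCalculus`
(`tsum_exp_shift'`, `Zl`); 0 `sorry`; 0 new definitions; 0 notation; 0 cited facts; NO printed statement.  Every letter is a DISPLAYED hypothesis on ARBITRARY
weights and kernels; nothing about Bałaban's operators is asserted.  HONEST: 0 root-level binders discharged (hW ∕ hR-sockets ∕ hSX-socket ∕ D1Tel ∕ D1Rep — 0);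
(K) NOT closed; NOT D1, NOT `BetaPertH`, NOT continuum, NOT Clay.
HONEST DEPENDENCY (cell records, verbatim): «continuum YM on T⁴ ⇐ BetaPertH ∧ nine spine estimates (0/9 proved); BetaPertH ⇐ (D1) ∧ (D4) ∧
CAP+tail; G-an2-4 gates asym, D1 and NE2/3/4.»

ABSOLUTE RULE (cell charter, verbatim): «No internally-minted statement may enter as a cited fact. Every hypothesis is either kernel-proved in
this package or a verbatim quotation of a PUBLISHED theorem with page reference. The manuscript(s) under audit are NOT citable for their own
disputed steps — they are the thing under adjudication; programme-internal (2001/route/tribunal) claims are never citable.»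

WHY.  The road's second-order tables are bi-vertices `vertex2OfK K n S₂ μ y ν y′` (OWNER PART 3b names the M-side table `vertex2OfK G₀ (m+1) S₂`; the N-side
one is `vertex2OfK (NlegRoad m a) n S₂,N` once (A2-N) names `S₂,N` — W-d1p2-g18-3): BOTH fine slots of a pair pack read through `K`'s `ℋ`-columns at the two
coarse bonds, i.e. block by block a nested superposition with weights `colH K n μ y`, `colH K n ν y′`.  The tadpole block words of `RestKernelBlockUnit` want the
tables' PLAIN block masses with DECAY IN THE COARSE SEPARATION; this file supplies the generic step — the two columns sit `|c₂ − c₁|₁` apart and the pair stencil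
couples them at rate `δ`: of the three exponentials, one half of each pays the coarse distance, the other halves pay the two lattice sums.

CONTENT (all [folklore]).
* §1 [any `D`] `exp_triangle_le`; **`tsum_tsum_exp_triangle_le`** (`Σ'_u Σ'_{u′} e^{−a|u−c₁|}·e^{−a|u′−c₂|}·e^{−δ|u′−u|} ≤ Zl D (a∕2)·Zl D (δ∕2)·e^{−r|c₂−c₁|}`,
  `r = min (a∕2) (δ∕2)`, with both summabilities).
* §2 [any `D`, fibre `F`, finite colour set `ι`] **`mass_nested_wsum_le`** (the statement in the title; inner and outer `mass_wsum_le` at the weight `W ≡ 1`, then §1).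
NOT HERE (honest): the packed tables (FILE `RestTableBlockMass`), any road object.
Unit `b2b-balaban-beta-d1-formalise-leaf-04` (gen 19), D1 formalisation swarm leaf prover 04, road «BF-x»; INTENT 3 «RK-TABLE BLOCK MASSES» FILE 3a (journal).
-/

noncomputable section

open Finset
open scoped BigOperators
open Literature.MathematicalPhysics.QuantumFieldTheory.Balaban1983to89
open Literature.MathematicalPhysics.QuantumFieldTheory.Balaban1983to89.Beta
open B12Sec2to5 (l1 l1_nonneg)
open ExpKernelCalculus (Site MKer Zl Zl_pos Zl_nonneg tsum_exp_shift' summable_exp_shift' l1_sub_triangle l1_sub_symm)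
open OneStepResolventKernel (wsum)
open Summit.QuantumFields.BalabanUV.Beta.D1BFx.GhostWordJetMass (mass_wsum_le mass_finset_sum_le)

namespace Summit.QuantumFields.BalabanUV.Beta.D1BFx.RestNestedMass

/-! ## §1 Three exponentials: half of each pays the coarse distance, the other halves pay the two lattice sums -/

section Exp

variable {D : ℕ}

/-- [folklore] **THE TRIANGLE SPLIT**: for `0 ≤ r ≤ a∕2`, `r ≤ δ∕2` (any real `a δ`),
`e^{−a|u−c₁|₁}·e^{−a|u′−c₂|₁}·e^{−δ|u′−u|₁} ≤ e^{−r|c₂−c₁|₁}·(e^{−(a∕2)|u−c₁|₁}·e^{−(δ∕2)|u′−u|₁})` (`|c₂ − c₁|₁ ≤ |u − c₁|₁ + |u′ − u|₁ + |u′ − c₂|₁`). -/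
theorem exp_triangle_le {a δ r : ℝ} (hr0 : 0 ≤ r) (hra : r ≤ a / 2) (hrδ : r ≤ δ / 2) (u u' c₁ c₂ : Site D) :
    Real.exp (-a * l1 (u - c₁)) * Real.exp (-a * l1 (u' - c₂)) * Real.exp (-δ * l1 (u' - u))
      ≤ Real.exp (-r * l1 (c₂ - c₁)) * (Real.exp (-(a / 2) * l1 (u - c₁)) * Real.exp (-(δ / 2) * l1 (u' - u))) := by
  rw [← Real.exp_add, ← Real.exp_add, ← Real.exp_add, ← Real.exp_add]
  apply Real.exp_le_exp.2
  have h1 := l1_nonneg (u - c₁)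
  have h2 := l1_nonneg (u' - c₂)
  have h3 := l1_nonneg (u' - u)
  -- `|c₂ − c₁| ≤ |c₂ − u′| + |u′ − u| + |u − c₁|`
  have t1 := l1_sub_triangle c₂ u' c₁
  have t2 := l1_sub_triangle u' u c₁
  rw [l1_sub_symm c₂ u'] at t1
  have ht : l1 (c₂ - c₁) ≤ l1 (u - c₁) + l1 (u' - u) + l1 (u' - c₂) := by linarith
  have e1 : r * l1 (c₂ - c₁) ≤ r * (l1 (u - c₁) + l1 (u' - u) + l1 (u' - c₂)) := mul_le_mul_of_nonneg_left ht hr0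
  nlinarith [mul_le_mul_of_nonneg_right hra h1, mul_le_mul_of_nonneg_right hrδ h3, mul_le_mul_of_nonneg_right hra h2,
    mul_nonneg hr0 h2]

/-- [folklore] **THE DOUBLE LATTICE SUM** (`0 < a`, `0 < δ`, `r = min (a∕2) (δ∕2)`): for every `u` the inner family
`u′ ↦ e^{−a|u−c₁|}·e^{−a|u′−c₂|}·e^{−δ|u′−u|}` is summable, the function `u ↦ Σ'_{u′} …` is summable, and
`Σ'_u Σ'_{u′} e^{−a|u−c₁|}·e^{−a|u′−c₂|}·e^{−δ|u′−u|} ≤ Zl D (a∕2)·Zl D (δ∕2)·e^{−r|c₂−c₁|}`. -/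
theorem tsum_tsum_exp_triangle_le {a δ : ℝ} (ha : 0 < a) (hδ : 0 < δ) (c₁ c₂ : Site D) :
    (∀ u : Site D, Summable fun u' : Site D =>
        Real.exp (-a * l1 (u - c₁)) * Real.exp (-a * l1 (u' - c₂)) * Real.exp (-δ * l1 (u' - u))) ∧
      (Summable fun u : Site D => ∑' u' : Site D,
        Real.exp (-a * l1 (u - c₁)) * Real.exp (-a * l1 (u' - c₂)) * Real.exp (-δ * l1 (u' - u))) ∧
      ∑' u : Site D, ∑' u' : Site D, Real.exp (-a * l1 (u - c₁)) * Real.exp (-a * l1 (u' - c₂)) * Real.exp (-δ * l1 (u' - u))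
        ≤ Zl D (a / 2) * Zl D (δ / 2) * Real.exp (-(min (a / 2) (δ / 2)) * l1 (c₂ - c₁)) := by
  set r : ℝ := min (a / 2) (δ / 2) with hr
  have hr0 : 0 ≤ r := le_min (by positivity) (by positivity)
  have ha2 : 0 < a / 2 := by positivity
  have hδ2 : 0 < δ / 2 := by positivity
  set E : ℝ := Real.exp (-r * l1 (c₂ - c₁)) with hE
  -- termwise majorant
  have hpt : ∀ u u' : Site D, Real.exp (-a * l1 (u - c₁)) * Real.exp (-a * l1 (u' - c₂)) * Real.exp (-δ * l1 (u' - u))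
      ≤ E * (Real.exp (-(a / 2) * l1 (u - c₁)) * Real.exp (-(δ / 2) * l1 (u' - u))) :=
    fun u u' => exp_triangle_le hr0 (min_le_left _ _) (min_le_right _ _) u u' c₁ c₂
  have h0 : ∀ u u' : Site D, 0 ≤ Real.exp (-a * l1 (u - c₁)) * Real.exp (-a * l1 (u' - c₂)) * Real.exp (-δ * l1 (u' - u)) :=
    fun u u' => by positivity
  -- inner sums
  have hin_maj : ∀ u : Site D, Summable fun u' : Site D => E * (Real.exp (-(a / 2) * l1 (u - c₁)) * Real.exp (-(δ / 2) * l1 (u' - u))) :=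
    fun u => ((summable_exp_shift' hδ2 u).mul_left (Real.exp (-(a / 2) * l1 (u - c₁)))).mul_left E
  have hin : ∀ u : Site D, Summable fun u' : Site D =>
      Real.exp (-a * l1 (u - c₁)) * Real.exp (-a * l1 (u' - c₂)) * Real.exp (-δ * l1 (u' - u)) :=
    fun u => Summable.of_nonneg_of_le (h0 u) (hpt u) (hin_maj u)
  have hin_le : ∀ u : Site D, ∑' u' : Site D, Real.exp (-a * l1 (u - c₁)) * Real.exp (-a * l1 (u' - c₂)) * Real.exp (-δ * l1 (u' - u))
      ≤ E * Real.exp (-(a / 2) * l1 (u - c₁)) * Zl D (δ / 2) := by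
    intro u
    refine ((hin u).tsum_le_tsum (hpt u) (hin_maj u)).trans (le_of_eq ?_)
    rw [tsum_mul_left, tsum_mul_left, tsum_exp_shift']
    ring
  -- outer sum
  have hout_maj : Summable fun u : Site D => E * Real.exp (-(a / 2) * l1 (u - c₁)) * Zl D (δ / 2) :=
    ((summable_exp_shift' ha2 c₁).mul_left E).mul_right _
  have h0' : ∀ u : Site D, 0 ≤ ∑' u' : Site D,
      Real.exp (-a * l1 (u - c₁)) * Real.exp (-a * l1 (u' - c₂)) * Real.exp (-δ * l1 (u' - u)) := fun u => tsum_nonneg (h0 u)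
  have hout : Summable fun u : Site D => ∑' u' : Site D,
      Real.exp (-a * l1 (u - c₁)) * Real.exp (-a * l1 (u' - c₂)) * Real.exp (-δ * l1 (u' - u)) :=
    Summable.of_nonneg_of_le h0' hin_le hout_maj
  refine ⟨hin, hout, ?_⟩
  calc ∑' u : Site D, ∑' u' : Site D, Real.exp (-a * l1 (u - c₁)) * Real.exp (-a * l1 (u' - c₂)) * Real.exp (-δ * l1 (u' - u))
      ≤ ∑' u : Site D, E * Real.exp (-(a / 2) * l1 (u - c₁)) * Zl D (δ / 2) := hout.tsum_le_tsum hin_le hout_maj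
    _ = E * (∑' u : Site D, Real.exp (-(a / 2) * l1 (u - c₁))) * Zl D (δ / 2) := by rw [tsum_mul_right, tsum_mul_left]
    _ = Zl D (a / 2) * Zl D (δ / 2) * E := by rw [tsum_exp_shift']; ring

end Exp

/-! ## §2 The plain mass of a nested superposition from two column envelopes and the pair pack's letter -/

section Nested

variable {D : ℕ} {F : Type*} [Fintype F] {ι : Type*} [Fintype ι]

/-- [folklore] **MASS OF A NESTED SUPERPOSITION**: weight families `w₁ w₂ : ι → Site D → ℝ` with envelopes `|w₁ i u| ≤ C₁·e^{−a|u−c₁|₁}`,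
`|w₂ i u′| ≤ C₂·e^{−a|u′−c₂|₁}` (`0 < a`, `0 ≤ C₁ C₂`) and pair stencils `P i u i′ u′` whose PLAIN masses are summable and `≤ mT·e^{−δ|u′−u|₁}` (`0 < δ`)
make the nested superposition `Σ_i wsum (w₁ i) (u ↦ Σ_{i′} wsum (w₂ i′) (P i u i′))` a kernel with summable plain mass
`≤ |ι|·|ι|·C₁·C₂·mT·Zl D (a∕2)·Zl D (δ∕2)·e^{−min (a∕2) (δ∕2)·|c₂−c₁|₁}` (inner and outer `GhostWordJetMass.mass_wsum_le` at the weight `W ≡ 1`, then §1). -/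
theorem mass_nested_wsum_le {w₁ w₂ : ι → Site D → ℝ} {P : ι → Site D → ι → Site D → MKer D F} {C₁ C₂ a δ mT : ℝ} {c₁ c₂ : Site D}
    (ha : 0 < a) (hδ : 0 < δ) (hC₁ : 0 ≤ C₁) (hC₂ : 0 ≤ C₂)
    (hw₁ : ∀ i u, |w₁ i u| ≤ C₁ * Real.exp (-a * l1 (u - c₁))) (hw₂ : ∀ i u, |w₂ i u| ≤ C₂ * Real.exp (-a * l1 (u - c₂)))
    (hPs : ∀ i u i' u', Summable fun p : Site D × Site D => ∑ g, ∑ f, |P i u i' u' p.1 p.2 g f|)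
    (hPm : ∀ i u i' u', ∑' p : Site D × Site D, ∑ g, ∑ f, |P i u i' u' p.1 p.2 g f| ≤ mT * Real.exp (-δ * l1 (u' - u))) :
    (Summable fun p : Site D × Site D =>
        ∑ g, ∑ f, |(∑ i, wsum (w₁ i) (fun u => ∑ i', wsum (w₂ i') (P i u i'))) p.1 p.2 g f|) ∧
      ∑' p : Site D × Site D, ∑ g, ∑ f, |(∑ i, wsum (w₁ i) (fun u => ∑ i', wsum (w₂ i') (P i u i'))) p.1 p.2 g f|
        ≤ (Fintype.card ι : ℝ) * (Fintype.card ι : ℝ) * C₁ * C₂ * mT * (Zl D (a / 2) * Zl D (δ / 2))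
          * Real.exp (-(min (a / 2) (δ / 2)) * l1 (c₂ - c₁)) := by
  set r : ℝ := min (a / 2) (δ / 2) with hr
  set Z : ℝ := Zl D (a / 2) * Zl D (δ / 2) with hZ
  set E : ℝ := Real.exp (-r * l1 (c₂ - c₁)) with hE
  have hZ0 : 0 ≤ Z := mul_nonneg (Zl_nonneg (by positivity)) (Zl_nonneg (by positivity))
  obtain ⟨hin, hout, hsum⟩ := tsum_tsum_exp_triangle_le ha hδ c₁ c₂
  -- the pair pack's letter forces `0 ≤ mT` as soon as a colour exists
  have hmT : ∀ _i : ι, 0 ≤ mT := fun i => by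
    have h := (tsum_nonneg fun p => Finset.sum_nonneg fun g _ => Finset.sum_nonneg fun f _ => abs_nonneg _).trans (hPm i c₁ i c₁)
    have e0 : l1 (c₁ - c₁ : Site D) = 0 := by simp [l1]
    rw [e0, mul_zero, Real.exp_zero, mul_one] at h
    exact h
  -- the inner coupling sum `Φ u := Σ'_{u′} e^{−a|u′−c₂|}·e^{−δ|u′−u|}`
  have hΦs : ∀ u : Site D, Summable fun u' : Site D => Real.exp (-a * l1 (u' - c₂)) * Real.exp (-δ * l1 (u' - u)) := fun u =>
    Summable.of_nonneg_of_le (fun u' => by positivity)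
      (fun u' => by
        have h1 : Real.exp (-a * l1 (u' - c₂)) ≤ 1 := Real.exp_le_one_iff.2 (by nlinarith [l1_nonneg (u' - c₂), ha.le])
        calc Real.exp (-a * l1 (u' - c₂)) * Real.exp (-δ * l1 (u' - u)) ≤ 1 * Real.exp (-δ * l1 (u' - u)) :=
              mul_le_mul_of_nonneg_right h1 (Real.exp_pos _).le
          _ = Real.exp (-δ * l1 (u' - u)) := one_mul _)
      (summable_exp_shift' hδ u)
  set Φ : Site D → ℝ := fun u => ∑' u' : Site D, Real.exp (-a * l1 (u' - c₂)) * Real.exp (-δ * l1 (u' - u)) with hΦ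
  have hΦ0 : ∀ u, 0 ≤ Φ u := fun u => tsum_nonneg fun u' => by positivity
  have hWpos : ∀ _p : Site D × Site D, (0 : ℝ) < 1 := fun _ => one_pos
  -- STEP A: the inner kernels `T i u := Σ_{i′} wsum (w₂ i′) (P i u i′)` have plain mass `≤ |ι|·C₂·mT·Φ u`
  have hA : ∀ i u, (Summable fun p : Site D × Site D => ∑ g, ∑ f, |(∑ i', wsum (w₂ i') (P i u i')) p.1 p.2 g f| * (1 : ℝ)) ∧
      ∑' p : Site D × Site D, ∑ g, ∑ f, |(∑ i', wsum (w₂ i') (P i u i')) p.1 p.2 g f| * (1 : ℝ)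
        ≤ ∑ _i' : ι, C₂ * mT * Φ u := by
    intro i u
    have hmT' := hmT i
    refine mass_finset_sum_le (Finset.univ : Finset ι) (fun p => (hWpos p).le) (fun i' _ => ?_) (fun i' _ => ?_)
    · exact (mass_wsum_le (W := fun _ => (1 : ℝ)) (ρ := fun u' => mT * Real.exp (-δ * l1 (u' - u))) hWpos
        (fun u' => by simpa only [mul_one] using hPs i u i' u') (fun u' => by simpa only [mul_one] using hPm i u i' u')
        (Summable.of_nonneg_of_le (fun u' => by positivity)
          (fun u' => by
            calc |w₂ i' u'| * (mT * Real.exp (-δ * l1 (u' - u)))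
                ≤ (C₂ * Real.exp (-a * l1 (u' - c₂))) * (mT * Real.exp (-δ * l1 (u' - u))) :=
                  mul_le_mul_of_nonneg_right (hw₂ i' u') (by positivity)
              _ = C₂ * mT * (Real.exp (-a * l1 (u' - c₂)) * Real.exp (-δ * l1 (u' - u))) := by ring)
          (((hΦs u).mul_left (C₂ * mT))))).1
    · refine (mass_wsum_le (W := fun _ => (1 : ℝ)) (ρ := fun u' => mT * Real.exp (-δ * l1 (u' - u))) hWpos
        (fun u' => by simpa only [mul_one] using hPs i u i' u') (fun u' => by simpa only [mul_one] using hPm i u i' u')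
        (Summable.of_nonneg_of_le (fun u' => by positivity)
          (fun u' => by
            calc |w₂ i' u'| * (mT * Real.exp (-δ * l1 (u' - u)))
                ≤ (C₂ * Real.exp (-a * l1 (u' - c₂))) * (mT * Real.exp (-δ * l1 (u' - u))) :=
                  mul_le_mul_of_nonneg_right (hw₂ i' u') (by positivity)
              _ = C₂ * mT * (Real.exp (-a * l1 (u' - c₂)) * Real.exp (-δ * l1 (u' - u))) := by ring)
          (((hΦs u).mul_left (C₂ * mT))))).2.trans ?_
      have hs1 : Summable fun u' => |w₂ i' u'| * (mT * Real.exp (-δ * l1 (u' - u))) :=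
        Summable.of_nonneg_of_le (fun u' => by positivity)
          (fun u' => by
            calc |w₂ i' u'| * (mT * Real.exp (-δ * l1 (u' - u)))
                ≤ (C₂ * Real.exp (-a * l1 (u' - c₂))) * (mT * Real.exp (-δ * l1 (u' - u))) :=
                  mul_le_mul_of_nonneg_right (hw₂ i' u') (by positivity)
              _ = C₂ * mT * (Real.exp (-a * l1 (u' - c₂)) * Real.exp (-δ * l1 (u' - u))) := by ring)
          ((hΦs u).mul_left (C₂ * mT))
      calc ∑' u', |w₂ i' u'| * (mT * Real.exp (-δ * l1 (u' - u)))
          ≤ ∑' u', C₂ * mT * (Real.exp (-a * l1 (u' - c₂)) * Real.exp (-δ * l1 (u' - u))) :=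
            hs1.tsum_le_tsum (fun u' => by
              calc |w₂ i' u'| * (mT * Real.exp (-δ * l1 (u' - u)))
                  ≤ (C₂ * Real.exp (-a * l1 (u' - c₂))) * (mT * Real.exp (-δ * l1 (u' - u))) :=
                    mul_le_mul_of_nonneg_right (hw₂ i' u') (by positivity)
                _ = C₂ * mT * (Real.exp (-a * l1 (u' - c₂)) * Real.exp (-δ * l1 (u' - u))) := by ring)
              ((hΦs u).mul_left (C₂ * mT))
        _ = C₂ * mT * Φ u := tsum_mul_left
  -- STEP B: the outer superposition
  have hρ : ∀ i u, ∑' p : Site D × Site D, ∑ g, ∑ f, |(∑ i', wsum (w₂ i') (P i u i')) p.1 p.2 g f| * (1 : ℝ)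
      ≤ (Fintype.card ι : ℝ) * C₂ * mT * Φ u := fun i u => by
    refine (hA i u).2.trans (le_of_eq ?_)
    rw [Finset.sum_const, Finset.card_univ, nsmul_eq_mul]
    ring
  -- the outer weight letter: `Σ'_u |w₁ i u|·(|ι| C₂ mT Φ u) ≤ |ι| C₁ C₂ mT · Z · E`
  have htermB : ∀ i u, |w₁ i u| * ((Fintype.card ι : ℝ) * C₂ * mT * Φ u)
      ≤ (Fintype.card ι : ℝ) * C₂ * mT * (C₁ * ∑' u' : Site D,
        Real.exp (-a * l1 (u - c₁)) * Real.exp (-a * l1 (u' - c₂)) * Real.exp (-δ * l1 (u' - u))) := by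
    intro i u
    have hmT' := hmT i
    have e : C₁ * ∑' u' : Site D, Real.exp (-a * l1 (u - c₁)) * Real.exp (-a * l1 (u' - c₂)) * Real.exp (-δ * l1 (u' - u))
        = C₁ * Real.exp (-a * l1 (u - c₁)) * Φ u := by
      rw [hΦ, ← tsum_mul_left, ← tsum_mul_left]
      exact tsum_congr fun u' => by ring
    rw [e]
    calc |w₁ i u| * ((Fintype.card ι : ℝ) * C₂ * mT * Φ u)
        ≤ (C₁ * Real.exp (-a * l1 (u - c₁))) * ((Fintype.card ι : ℝ) * C₂ * mT * Φ u) :=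
          mul_le_mul_of_nonneg_right (hw₁ i u) (by have := hΦ0 u; positivity)
      _ = (Fintype.card ι : ℝ) * C₂ * mT * (C₁ * Real.exp (-a * l1 (u - c₁)) * Φ u) := by ring
  have hmajB : ∀ _i : ι, Summable fun u : Site D => (Fintype.card ι : ℝ) * C₂ * mT * (C₁ * ∑' u' : Site D,
      Real.exp (-a * l1 (u - c₁)) * Real.exp (-a * l1 (u' - c₂)) * Real.exp (-δ * l1 (u' - u))) :=
    fun _ => (hout.mul_left C₁).mul_left _
  have hwsB : ∀ i, Summable fun u : Site D => |w₁ i u| * ((Fintype.card ι : ℝ) * C₂ * mT * Φ u) := fun i =>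
    Summable.of_nonneg_of_le (fun u => by have := hΦ0 u; have := hmT i; positivity) (htermB i) (hmajB i)
  have hwmB : ∀ i, ∑' u : Site D, |w₁ i u| * ((Fintype.card ι : ℝ) * C₂ * mT * Φ u)
      ≤ (Fintype.card ι : ℝ) * C₁ * C₂ * mT * Z * E := by
    intro i
    have hmT' := hmT i
    calc ∑' u : Site D, |w₁ i u| * ((Fintype.card ι : ℝ) * C₂ * mT * Φ u)
        ≤ ∑' u : Site D, (Fintype.card ι : ℝ) * C₂ * mT * (C₁ * ∑' u' : Site D,
            Real.exp (-a * l1 (u - c₁)) * Real.exp (-a * l1 (u' - c₂)) * Real.exp (-δ * l1 (u' - u))) :=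
          (hwsB i).tsum_le_tsum (htermB i) (hmajB i)
      _ = (Fintype.card ι : ℝ) * C₂ * mT * (C₁ * ∑' u : Site D, ∑' u' : Site D,
            Real.exp (-a * l1 (u - c₁)) * Real.exp (-a * l1 (u' - c₂)) * Real.exp (-δ * l1 (u' - u))) := by
          rw [tsum_mul_left, tsum_mul_left]
      _ ≤ (Fintype.card ι : ℝ) * C₂ * mT * (C₁ * (Z * E)) := by
          have h := mul_le_mul_of_nonneg_left hsum hC₁
          exact mul_le_mul_of_nonneg_left h (by positivity)
      _ = (Fintype.card ι : ℝ) * C₁ * C₂ * mT * Z * E := by ring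
  have hB := mass_finset_sum_le (Finset.univ : Finset ι) (W := fun _ => (1 : ℝ)) (fun p => (hWpos p).le)
    (fun i _ => (mass_wsum_le (W := fun _ => (1 : ℝ)) (w := w₁ i) (K := fun u => ∑ i', wsum (w₂ i') (P i u i'))
      (ρ := fun u => (Fintype.card ι : ℝ) * C₂ * mT * Φ u) hWpos (fun u => (hA i u).1) (fun u => hρ i u) (hwsB i)).1)
    (fun i _ => (mass_wsum_le (W := fun _ => (1 : ℝ)) (w := w₁ i) (K := fun u => ∑ i', wsum (w₂ i') (P i u i'))
      (ρ := fun u => (Fintype.card ι : ℝ) * C₂ * mT * Φ u) hWpos (fun u => (hA i u).1) (fun u => hρ i u) (hwsB i)).2.trans (hwmB i))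
  refine ⟨by simpa only [mul_one] using hB.1, ?_⟩
  have h2 := hB.2
  simp only [mul_one] at h2
  refine h2.trans (le_of_eq ?_)
  rw [Finset.sum_const, Finset.card_univ, nsmul_eq_mul]
  ring

end Nested

end Summit.QuantumFields.BalabanUV.Beta.D1BFx.RestNestedMass

end
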